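import Summits.ABC.IUTFork.Conditional.WRowBrobergUniformM
import Summits.ABC.IUTFork.Conditional.WRowBrobergUniformDatum
import HarnessLib

/-!
# Branch C / R-W, reading (U), M line: Broberg's point `(ℚ(√7), λ)`, `λ = (8−3√7)²(5−2√7)/(4−3√7)⁴` — the M-SETTING twin of
# `WRow.licence_broberg_all` (`Conditional/WRowBrobergUniformDatum`): the M books' (U) binder is INHABITED AS TYPED at EVERY genuine Θ-volume
# datum over Broberg's point, EVERY level, EVERY idele datum — the one NUMBER-FIELD row of the R-W table, now twinned
# (abc-iut cell, branch C, row «C:BROBERG-M-TWIN» step (c); seat abc-iut-C-cert-2 gen 8; C LEAD KEY `KEY-abc-iut-C-cert-2-BROBERGMTWIN.md` 2026-08-27T15:16Z)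

Record-only PROOF file (D-0012; 0 definitions, 0 `Prop` facts, nothing re-typed) of the abc-iut cell. TAKES NO SIDE on [IUTchIII] Cor. 3.12
(S. Mochizuki, *Inter-universal Teichmüller theory III*, Cor. 3.12 p. 173–174; Step (xi-f) p. 184) or on any author; «inhabited as typed» ≠
«asserted in print».

`WRow.licence_broberg_all` (abc-iut-C-cert-2 gen 3) = the X-generic `WRow.licence_of_brobergTypes_all` at `X := pilotDataOfK T.D T.K` fed with the
DERIVED fibre shape of a genuine datum over Broberg's point, `WRow.exists_brobergTypes T` (p496514: bad places over `3`, `47` only; over `3` two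
types `e ∈ 10lℕ` / `30lℕ` with `P_q = 12e/l` / `e/l`, over `47` one type `e ∈ 15lℕ`, `P_q = 4e/l`; same-type completions isomorphic). THIS FILE
is its M twin («wrapper», 4 proof lines): the SAME `WRow.exists_brobergTypes T` BY NAME, fed to step (b)'s `WRowM.licence_of_brobergTypes_all`
(surgery twin over the K→M transfer MIXED socket `WRowM.licence_tOfIdeleData_of_mixedOrdersK`, step (a)) — so NO rationality of `j` is used
anywhere: Broberg's `F_mod = ℚ(√7)` is admitted as is.

* **`WRowM.licence_broberg_all_M {l : ℕ} (T : Cor22.ThetaVolumeDatumAt Broberg.point l)`** — for EVERY idele datum `r` of `T.D`, every analytic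
  `logvK`, every context datum and any `htq0/Sq/htq1`: `Thm311ToCor312.Licence (settingPrVolSharpM T.D hlog (tOfIdeleData T.D r) (tqM … r …) …)`;
* `WRowM.licence_broberg_seven_M` / `WRowM.licence_broberg_eleven_M` — the R-W table rows `l = 7`, `l = 11` (one-line instances).

READING (neutral): census words «every kernel-INHABITED row of the K line, the number-field row INCLUDED, has its M-setting twin AS TYPED».
HONEST SCOPE: OUR sharp genuine containers and Dupuy–Hilado's typed (Ind1)/(Ind2); STRONGER-THAN-PRINT hull reading; a socket / twin discharges
nothing; NON-EMPTINESS of the datum type, admissibility / (P6), Szpiro-badness NOT claimed; existence of initial Θ-data over Broberg's point NOT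
claimed; nothing about the printed GLOBAL inequality or the number-level corollary; typed ≠ proved; instantiated ≠ endorsed; no abc claim.
[cite: Mochizuki2012, IUTchI Def. 3.1 (b),(c),(e) pp. 61–62, Rmk. 3.1.5 p. 65, Ex. 3.2 (iv) p. 71; IUTchIII Cor. 3.12 Step (xi-d) p. 183, (xi-f)
p. 184, Thm. 3.11 (i) (Ind1)(Ind2) p. 154; IUTchIV Prop. 1.1 p. 9, Prop. 1.2 (i)(ii) p. 10, Prop. 1.4 (i)(ii) p. 13] [cite: DupuyHilado2025, §3.3,
§3.4, §3.9, §4.9, §4.12] [cite: NeukirchANT1999, Ch. II (5.5)–(5.7)] [claim: Mochizuki2012, status: disputed] for every IUT sentence.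
PROOF-ONLY: no definitions.
-/

noncomputable section

open Set Function Metric NumberField IsDedekindDomain

namespace Summit.ABC.IUTFork.Conditional

open Thm311 Thm311.Real Cor312 Cor312Vol Cor312Prov Literature.IUT.LogThetaLattice Literature.IUT.LogVolume
  Literature.IUT.HodgeTheaters Literature.IUT.LogVolume.Cor22
open Literature.NumberTheory.NumberFields Literature.NumberTheory.GaloisRepresentations.Ultrametric
open Literature.NumberTheory.DiophantineGeometry Literature.NumberTheory.DiophantineGeometry.GenEll

/-- **M TWIN of `WRow.licence_broberg_all`**: for EVERY level `l`, EVERY genuine Θ-volume datum `T : Cor22.ThetaVolumeDatumAt Broberg.point l` and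
EVERY idele datum `r` of `T.D` — `Thm311ToCor312.Licence` at the M-LEVEL setting `settingPrVolSharpM T.D hlog (tOfIdeleData T.D r) (tqM … r …) …`
(every analytic `logvK`, every context datum, any `htq0/Sq/htq1`); hypotheses = the datum ONLY. Proof: `WRow.exists_brobergTypes T` BY NAME into
`WRowM.licence_of_brobergTypes_all`. The M books' (U) binder is INHABITED AS TYPED at every genuine datum over Broberg's point. K docstring, for
the record: «**Broberg's point, EVERY level `l`: INHABITED SIDE — UNCONDITIONAL and UNIFORM.** For EVERY `l`, EVERY genuine Θ-volume datum `T` at `(Broberg.point, l)` (`F_tpd = ℚ(√7)`, `λ = (8−3√7)²(5−2√7)/(4−3√7)⁴`), any analytic `p`-adic logarithms and EVERY pair of Θ- and q-ideles REALISING the pilot divisors of `X := pilotDataOfK T.D T.K`: abc-iut-c312-1's `Thm311ToCor312.Licence` HOLDS at abc-iut-c312-7's `settingPrVolSharp X …`. The fibre shape fed to `WRow.licence_of_brobergTypes_all` — bad places over `3`, `47` only; over `3` the two types `𝔭₃' = (√7−2)` (`h = 24`, `e ∈ 10lℕ`) and `𝔭₃ = (2+√7)` (`h = 2`, `e ∈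 30lℕ`), over `47` the type `𝔭₄₇ = (3√7−4)` (`h = 8`, `e ∈ 15lℕ`); same type ⇒ `ℚ_p`-isom»
[cite: Mochizuki2012, IUTchIII Cor. 3.12 Step (xi-f) p. 184, Thm. 3.11 (i) p. 154; IUTchIV Prop. 1.2 (i)(ii) p. 10, Prop. 1.4 (i)(ii) p. 13]
[cite: DupuyHilado2025, §3.3, §3.4, §3.9, §4.9, §4.12] [claim: Mochizuki2012, status: disputed] -/
theorem WRowM.licence_broberg_all_M {l : ℕ} (T : Cor22.ThetaVolumeDatumAt Broberg.point l) :
    letI := T.instFieldF; letI := T.instNumberFieldF; letI := T.instAlgebraF; letI := T.instFieldK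
    letI := T.instNumberFieldK; letI := T.instAlgebraK; letI := T.instFieldFbar; letI := T.instAlgebraFbar
    letI := T.instAlgebraKFbar; letI := T.instIsElliptic
    ∀ {logvK : PadicLogsVal T.K} (hlog : LogvAnalyticVal logvK) (r : ThetaData.IdeleData T.D) (M : Type) [Field M] [NumberField M]
      (archPk : ∀ (j : (thetaIndexOfInitial T.D).Label) (vQ : (thetaIndexOfInitial T.D).VQ),
        Set ((logShellsOfInitialDH T.D logvK).Packet j vQ))
      (archSub : ∀ (j : (thetaIndexOfInitial T.D).Label) (v : (thetaIndexOfInitial T.D).V),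
        Set ((logShellsOfInitialDH T.D logvK).Packet j ((thetaIndexOfInitial T.D).over v)))
      (Ψ : ℤ → ∀ v : (thetaIndexOfInitial T.D).V, v ∈ (thetaIndexOfInitial T.D).Vbad →
        Set ((logShellsOfInitialDH T.D logvK).StarPacket v))
      (act : ℤ → ∀ v : (thetaIndexOfInitial T.D).V, v ∈ (thetaIndexOfInitial T.D).Vbad →
        (logShellsOfInitialDH T.D logvK).StarPacket v → Module.End ℚ ((logShellsOfInitialDH T.D logvK).StarPacket v))
      (Mmod : ℤ → ∀ j : (thetaIndexOfInitial T.D).LabelStar, Set ((logShellsOfInitialDH T.D logvK).GlobalPacket j.1))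
      (region : ℤ → ∀ j : (thetaIndexOfInitial T.D).LabelStar, FinDivisor M → ∀ vQ : (thetaIndexOfInitial T.D).VQ,
        Set ((logShellsOfInitialDH T.D logvK).Packet j.1 vQ))
      (n : ℤ) {HT : Type} {LogLink : HT → HT → Type} {IsFull : ∀ {s t : HT}, LogLink s t → Prop}
      (lat : LGPGaussianLogThetaLattice LogLink IsFull)
      {Frd : Type} {IsoF : Frd → Frd → Type} {Ob : Frd → Type} {realify : Frd → Frd} {Strip : Type}
      {IsoS : Strip → Strip → Type}
      {Mv : ∀ v : (thetaIndexOfInitial T.D).V, v ∈ (thetaIndexOfInitial T.D).Vbad → Type} [∀ v h, Monoid (Mv v h)]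
      (sig : GlobalLGPFrobenioidSignature (thetaIndexOfInitial T.D).lstar (thetaIndexOfInitial T.D).V
        (· ∈ (thetaIndexOfInitial T.D).Vbad) Frd IsoF Ob realify Strip IsoS Mv)
      (split : SplittingMonoids Mv) {ObΔ : Type}
      {N : ∀ v : (thetaIndexOfInitial T.D).V, v ∈ (thetaIndexOfInitial T.D).Vbad → Type} [∀ v h, Monoid (N v h)]
      (qData : QPilotData ObΔ N)
      (htq0 : ∀ (u : FinitePlace ℚ) (x : (thetaIndexOfInitial T.D).Fibre (Val.non u)),
        tqM T.D (ratChar u) u (natCast_ratChar_mem u) r x ≠ 0)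
      (Sq : Finset (FinitePlace ℚ))
      (htq1 : ∀ (u : FinitePlace ℚ) (x : (thetaIndexOfInitial T.D).Fibre (Val.non u)), u ∉ Sq →
        ‖tqM T.D (ratChar u) u (natCast_ratChar_mem u) r x‖ = 1),
      Thm311ToCor312.Licence
        (settingPrVolSharpM T.D hlog (tOfIdeleData T.D r) (fun u x => tqM T.D (ratChar u) u (natCast_ratChar_mem u) r x) M archPk
          archSub Ψ act Mmod region n lat sig split qData htq0 Sq htq1) := by
  letI := T.instFieldF; letI := T.instNumberFieldF; letI := T.instAlgebraF; letI := T.instFieldK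
  letI := T.instNumberFieldK; letI := T.instAlgebraK; letI := T.instFieldFbar; letI := T.instAlgebraFbar
  letI := T.instAlgebraKFbar; letI := T.instIsElliptic
  intro logvK hlog r M _ _ archPk archSub Ψ act Mmod region n HT LogLink IsFull lat Frd IsoF Ob realify Strip IsoS Mv _ sig split ObΔ N _
    qData htq0 Sq htq1
  obtain ⟨c, eA, eB, eC, hdA, hdB, hdC, hbad, h3, h47, hiso⟩ := WRow.exists_brobergTypes T
  exact WRowM.licence_of_brobergTypes_all T.D hlog r M archPk archSub Ψ act Mmod region n lat sig split qData htq0 Sq htq1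
    (pilotDataOfK_l T.D T.K) T.D.five_le_l c eA eB eC hdA hdB hdC hbad h3 h47 hiso

/-- **The R-W table row broberg-Q7:7, M side**: `l = 7`. [cite: Mochizuki2012, IUTchIII Cor. 3.12 Step (xi-f) p. 184] [claim: Mochizuki2012, status: disputed] -/
theorem WRowM.licence_broberg_seven_M (T : Cor22.ThetaVolumeDatumAt Broberg.point 7) :
    letI := T.instFieldF; letI := T.instNumberFieldF; letI := T.instAlgebraF; letI := T.instFieldK
    letI := T.instNumberFieldK; letI := T.instAlgebraK; letI := T.instFieldFbar; letI := T.instAlgebraFbar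
    letI := T.instAlgebraKFbar; letI := T.instIsElliptic
    ∀ {logvK : PadicLogsVal T.K} (hlog : LogvAnalyticVal logvK) (r : ThetaData.IdeleData T.D) (M : Type) [Field M] [NumberField M]
      (archPk : ∀ (j : (thetaIndexOfInitial T.D).Label) (vQ : (thetaIndexOfInitial T.D).VQ),
        Set ((logShellsOfInitialDH T.D logvK).Packet j vQ))
      (archSub : ∀ (j : (thetaIndexOfInitial T.D).Label) (v : (thetaIndexOfInitial T.D).V),
        Set ((logShellsOfInitialDH T.D logvK).Packet j ((thetaIndexOfInitial T.D).over v)))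
      (Ψ : ℤ → ∀ v : (thetaIndexOfInitial T.D).V, v ∈ (thetaIndexOfInitial T.D).Vbad →
        Set ((logShellsOfInitialDH T.D logvK).StarPacket v))
      (act : ℤ → ∀ v : (thetaIndexOfInitial T.D).V, v ∈ (thetaIndexOfInitial T.D).Vbad →
        (logShellsOfInitialDH T.D logvK).StarPacket v → Module.End ℚ ((logShellsOfInitialDH T.D logvK).StarPacket v))
      (Mmod : ℤ → ∀ j : (thetaIndexOfInitial T.D).LabelStar, Set ((logShellsOfInitialDH T.D logvK).GlobalPacket j.1))
      (region : ℤ → ∀ j : (thetaIndexOfInitial T.D).LabelStar, FinDivisor M → ∀ vQ : (thetaIndexOfInitial T.D).VQ,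
        Set ((logShellsOfInitialDH T.D logvK).Packet j.1 vQ))
      (n : ℤ) {HT : Type} {LogLink : HT → HT → Type} {IsFull : ∀ {s t : HT}, LogLink s t → Prop}
      (lat : LGPGaussianLogThetaLattice LogLink IsFull)
      {Frd : Type} {IsoF : Frd → Frd → Type} {Ob : Frd → Type} {realify : Frd → Frd} {Strip : Type}
      {IsoS : Strip → Strip → Type}
      {Mv : ∀ v : (thetaIndexOfInitial T.D).V, v ∈ (thetaIndexOfInitial T.D).Vbad → Type} [∀ v h, Monoid (Mv v h)]
      (sig : GlobalLGPFrobenioidSignature (thetaIndexOfInitial T.D).lstar (thetaIndexOfInitial T.D).V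
        (· ∈ (thetaIndexOfInitial T.D).Vbad) Frd IsoF Ob realify Strip IsoS Mv)
      (split : SplittingMonoids Mv) {ObΔ : Type}
      {N : ∀ v : (thetaIndexOfInitial T.D).V, v ∈ (thetaIndexOfInitial T.D).Vbad → Type} [∀ v h, Monoid (N v h)]
      (qData : QPilotData ObΔ N)
      (htq0 : ∀ (u : FinitePlace ℚ) (x : (thetaIndexOfInitial T.D).Fibre (Val.non u)),
        tqM T.D (ratChar u) u (natCast_ratChar_mem u) r x ≠ 0)
      (Sq : Finset (FinitePlace ℚ))
      (htq1 : ∀ (u : FinitePlace ℚ) (x : (thetaIndexOfInitial T.D).Fibre (Val.non u)), u ∉ Sq →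
        ‖tqM T.D (ratChar u) u (natCast_ratChar_mem u) r x‖ = 1),
      Thm311ToCor312.Licence
        (settingPrVolSharpM T.D hlog (tOfIdeleData T.D r) (fun u x => tqM T.D (ratChar u) u (natCast_ratChar_mem u) r x) M archPk
          archSub Ψ act Mmod region n lat sig split qData htq0 Sq htq1) :=
  WRowM.licence_broberg_all_M T

/-- **The R-W table row broberg-Q7:11, M side**: `l = 11`. [cite: Mochizuki2012, IUTchIII Cor. 3.12 Step (xi-f) p. 184] [claim: Mochizuki2012, status: disputed] -/
theorem WRowM.licence_broberg_eleven_M (T : Cor22.ThetaVolumeDatumAt Broberg.point 11) :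
    letI := T.instFieldF; letI := T.instNumberFieldF; letI := T.instAlgebraF; letI := T.instFieldK
    letI := T.instNumberFieldK; letI := T.instAlgebraK; letI := T.instFieldFbar; letI := T.instAlgebraFbar
    letI := T.instAlgebraKFbar; letI := T.instIsElliptic
    ∀ {logvK : PadicLogsVal T.K} (hlog : LogvAnalyticVal logvK) (r : ThetaData.IdeleData T.D) (M : Type) [Field M] [NumberField M]
      (archPk : ∀ (j : (thetaIndexOfInitial T.D).Label) (vQ : (thetaIndexOfInitial T.D).VQ),
        Set ((logShellsOfInitialDH T.D logvK).Packet j vQ))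
      (archSub : ∀ (j : (thetaIndexOfInitial T.D).Label) (v : (thetaIndexOfInitial T.D).V),
        Set ((logShellsOfInitialDH T.D logvK).Packet j ((thetaIndexOfInitial T.D).over v)))
      (Ψ : ℤ → ∀ v : (thetaIndexOfInitial T.D).V, v ∈ (thetaIndexOfInitial T.D).Vbad →
        Set ((logShellsOfInitialDH T.D logvK).StarPacket v))
      (act : ℤ → ∀ v : (thetaIndexOfInitial T.D).V, v ∈ (thetaIndexOfInitial T.D).Vbad →
        (logShellsOfInitialDH T.D logvK).StarPacket v → Module.End ℚ ((logShellsOfInitialDH T.D logvK).StarPacket v))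
      (Mmod : ℤ → ∀ j : (thetaIndexOfInitial T.D).LabelStar, Set ((logShellsOfInitialDH T.D logvK).GlobalPacket j.1))
      (region : ℤ → ∀ j : (thetaIndexOfInitial T.D).LabelStar, FinDivisor M → ∀ vQ : (thetaIndexOfInitial T.D).VQ,
        Set ((logShellsOfInitialDH T.D logvK).Packet j.1 vQ))
      (n : ℤ) {HT : Type} {LogLink : HT → HT → Type} {IsFull : ∀ {s t : HT}, LogLink s t → Prop}
      (lat : LGPGaussianLogThetaLattice LogLink IsFull)
      {Frd : Type} {IsoF : Frd → Frd → Type} {Ob : Frd → Type} {realify : Frd → Frd} {Strip : Type}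
      {IsoS : Strip → Strip → Type}
      {Mv : ∀ v : (thetaIndexOfInitial T.D).V, v ∈ (thetaIndexOfInitial T.D).Vbad → Type} [∀ v h, Monoid (Mv v h)]
      (sig : GlobalLGPFrobenioidSignature (thetaIndexOfInitial T.D).lstar (thetaIndexOfInitial T.D).V
        (· ∈ (thetaIndexOfInitial T.D).Vbad) Frd IsoF Ob realify Strip IsoS Mv)
      (split : SplittingMonoids Mv) {ObΔ : Type}
      {N : ∀ v : (thetaIndexOfInitial T.D).V, v ∈ (thetaIndexOfInitial T.D).Vbad → Type} [∀ v h, Monoid (N v h)]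
      (qData : QPilotData ObΔ N)
      (htq0 : ∀ (u : FinitePlace ℚ) (x : (thetaIndexOfInitial T.D).Fibre (Val.non u)),
        tqM T.D (ratChar u) u (natCast_ratChar_mem u) r x ≠ 0)
      (Sq : Finset (FinitePlace ℚ))
      (htq1 : ∀ (u : FinitePlace ℚ) (x : (thetaIndexOfInitial T.D).Fibre (Val.non u)), u ∉ Sq →
        ‖tqM T.D (ratChar u) u (natCast_ratChar_mem u) r x‖ = 1),
      Thm311ToCor312.Licence
        (settingPrVolSharpM T.D hlog (tOfIdeleData T.D r) (fun u x => tqM T.D (ratChar u) u (natCast_ratChar_mem u) r x) M archPk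
          archSub Ψ act Mmod region n lat sig split qData htq0 Sq htq1) :=
  WRowM.licence_broberg_all_M T

end Summit.ABC.IUTFork.Conditional

end
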